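import Literature.Geometry.DiscreteGeometry.KissingNumberThreeProofs
import HarnessLib

/-!
# A saturated ball blocks all its free slots strictly (kissing number `12 ⇒` no thirteenth direction)

HONEST FRAMING. Part of the venture `Summits/Ventures/Crystal3D` (cell `crystal3d-full`), helper for the
crux `GenericWallFloor` (stmt-Ventures-19480) of `route-Ventures-StickyWulffConstant`, line `WallLedgerG`,
rigid-bicrystal rung of `stub_twoSlabAdhesion` (note RIGID-RUNG-ARCH on the item, open module M7: what a
SATURATED top site forces).  Elementary consequence of the tree's kissing-number theorem
(`Literature.Geometry.DiscreteGeometry.musin2006_kissing_three_holds`, Musin 2006); nothing else.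

* `exists_dist_lt_one_of_twelve_contacts` — if a ball centred at `p` touches twelve balls (centres `K`,
  `dist p q = 1`, pairwise `≥ 1` apart), then EVERY further point `z` at distance `1` from `p` is at
  distance `< 1` from one of the twelve: a saturated ball has no free kissing position, every empty slot
  position of a saturated lattice ball is strictly blocked by one of its neighbours.
* `card_le_eleven_of_free_position` — contrapositive: a free unit position forces `#K ≤ 11`.

WHAT THIS IS NOT: any statement about the crux stub; rung F-C1 not moved.
-/

noncomputable section

namespace Summit.Ventures.Crystal3D.Theorems

open Finset
open Literature.Geometry.DiscreteGeometry (musin2006_kissing_three_holds)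

/-- **A thirteenth kissing position does not exist.**  `K` twelve points at distance `1` from `p`,
pairwise at distance `≥ 1`; then every `z ∉ K` with `dist p z = 1` has `dist z q < 1` for some `q ∈ K`. -/
theorem exists_dist_lt_one_of_twelve_contacts (p z : EuclideanSpace ℝ (Fin 3))
    (K : Finset (EuclideanSpace ℝ (Fin 3))) (hK : ∀ q ∈ K, dist p q = 1)
    (hsep : ∀ q ∈ K, ∀ q' ∈ K, q ≠ q' → 1 ≤ dist q q') (hcard : K.card = 12)
    (hz : dist p z = 1) (hzK : z ∉ K) : ∃ q ∈ K, dist z q < 1 := by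
  classical
  by_contra hcon
  push Not at hcon
  -- the thirteen unit vectors `q - p`, `q ∈ insert z K`
  set T : Finset (EuclideanSpace ℝ (Fin 3)) := (insert z K).image (fun q => q - p) with hT
  have hinj : Set.InjOn (fun q : EuclideanSpace ℝ (Fin 3) => q - p) ↑(insert z K) :=
    fun a _ b _ h => sub_left_injective h
  have hTcard : T.card = 13 := by
    rw [hT, card_image_of_injOn hinj, card_insert_of_notMem hzK, hcard]
  have hnorm : ∀ v ∈ T, ‖v‖ = 1 := by
    intro v hv
    obtain ⟨q, hq, rfl⟩ := mem_image.1 hv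
    rw [← dist_eq_norm, dist_comm]
    rcases mem_insert.1 hq with rfl | hq
    · exact hz
    · exact hK q hq
  have hdist : ∀ v ∈ T, ∀ w ∈ T, v ≠ w → 1 ≤ dist v w := by
    intro v hv w hw hvw
    obtain ⟨a, ha0, rfl⟩ := mem_image.1 hv
    obtain ⟨b, hb0, rfl⟩ := mem_image.1 hw
    have hab : a ≠ b := fun h => hvw (by rw [h])
    rw [dist_eq_norm, sub_sub_sub_cancel_right, ← dist_eq_norm]
    rcases mem_insert.1 ha0 with rfl | ha <;> rcases mem_insert.1 hb0 with rfl | hb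
    · exact absurd rfl hab
    · exact hcon b hb
    · rw [dist_comm]; exact hcon a ha
    · exact hsep a ha b hb hab
  have h12 := musin2006_kissing_three_holds T hnorm hdist
  omega

/-- **Contrapositive: a free unit position bounds the coordination by eleven.**  If some `z` at distance
`1` from `p` is at distance `≥ 1` from every point of `K` (and `z ∉ K`), then `#K ≤ 11`. -/
theorem card_le_eleven_of_free_position (p z : EuclideanSpace ℝ (Fin 3))
    (K : Finset (EuclideanSpace ℝ (Fin 3))) (hK : ∀ q ∈ K, dist p q = 1)
    (hsep : ∀ q ∈ K, ∀ q' ∈ K, q ≠ q' → 1 ≤ dist q q')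
    (hz : dist p z = 1) (hzK : z ∉ K) (hfree : ∀ q ∈ K, 1 ≤ dist z q) : K.card ≤ 11 := by
  classical
  -- `insert z K` is a kissing configuration about `p`, hence has at most twelve points
  set T : Finset (EuclideanSpace ℝ (Fin 3)) := (insert z K).image (fun q => q - p) with hT
  have hinj : Set.InjOn (fun q : EuclideanSpace ℝ (Fin 3) => q - p) ↑(insert z K) :=
    fun a _ b _ h => sub_left_injective h
  have hTcard : T.card = K.card + 1 := by
    rw [hT, card_image_of_injOn hinj, card_insert_of_notMem hzK]
  have hnorm : ∀ v ∈ T, ‖v‖ = 1 := by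
    intro v hv
    obtain ⟨q, hq, rfl⟩ := mem_image.1 hv
    rw [← dist_eq_norm, dist_comm]
    rcases mem_insert.1 hq with rfl | hq
    · exact hz
    · exact hK q hq
  have hdist : ∀ v ∈ T, ∀ w ∈ T, v ≠ w → 1 ≤ dist v w := by
    intro v hv w hw hvw
    obtain ⟨a, ha0, rfl⟩ := mem_image.1 hv
    obtain ⟨b, hb0, rfl⟩ := mem_image.1 hw
    have hab : a ≠ b := fun h => hvw (by rw [h])
    rw [dist_eq_norm, sub_sub_sub_cancel_right, ← dist_eq_norm]
    rcases mem_insert.1 ha0 with rfl | ha <;> rcases mem_insert.1 hb0 with rfl | hb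
    · exact absurd rfl hab
    · exact hfree b hb
    · rw [dist_comm]; exact hfree a ha
    · exact hsep a ha b hb hab
  have h12 := musin2006_kissing_three_holds T hnorm hdist
  omega

end Summit.Ventures.Crystal3D.Theorems

end
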